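import Literature.Barriers.ResolutionOfSingularities.ResidualOrderUnboundedBlowup
import Literature.Barriers.ResolutionOfSingularities.ResidualOrderUnboundedProofs
import HarnessLib

/-!
# Orders, residual orders and symmetries along point blow-up sequences (toolkit, part 2)

`Literature/Barriers/ResolutionOfSingularities/ResidualOrderUnboundedBounds.lean` — second part of
the toolkit for the proof of `HauserPerlega.HauserPerlega2019` (`ResidualOrderUnbounded.lean`),
built on `ResidualOrderUnboundedBlowup.lean` and on the generic bounds of
`ResidualOrderUnboundedProofs.lean` (section `ResidualBounds`: `ordAlong_le_apply_of_mem_support`,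
`exceptionalExp_le_exponent_of_mem_support`, `natCast_le_residualOrder_of_bounds`, which this
file REUSES rather than restates):

* `le_ordZero_of_forall_mem_support`: `ord F ≥ n` as soon as every monomial of `F` has degree
  `≥ n` (the `F.support` form of `Literature.Barriers.ResolutionOfSingularities.le_ordZero_of_forall`
  of `KangarooShadeIncrease.lean`, which is not in the import closure here);
* `le_residualOrder`: the lower bound for the residual order in the form the Example files
  consume — for EVERY exceptional set `Δ`: if each `xᵢ` occurs with exponent `≤ mᵢ` in some
  monomial of `F` and all monomials have degree `≥ N + Σᵢ mᵢ` (sum over all variables), then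
  `residual.order_Δ F ≥ N` (a corollary of `natCast_le_residualOrder_of_bounds`)
  [cite: HauserPerlega2019, §2 (residual order)]; `exists_nat_eq_residualOrder`: the residual
  order of `F ≠ 0` is finite;
* `deletePthPowers_sum`: cleaning is additive over finite sums;
* `seqF`, `seqΔ`, `isPointBlowupSequence_seq`: the sequence generated from `F⁰` by iterating
  `blowupStep` along a schedule of charts `j k` and translations `t k` is a point blow-up sequence
  (`IsPointBlowupSequence`) once `F⁰` is clean and all orders stay `≥ q`;
* renaming the variables by a permutation `s` (`MvPolynomial.rename s`) commutes with
  `blowupStep` (`rename_blowupStep`) and transports degree bounds (`degree_bound_rename`) and the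
  hypotheses of `le_residualOrder` (`residualBound_rename`) — used for the `y ↔ u` symmetry
  between consecutive cycles of Hauser–Perlega's first example
  [cite: HauserPerlega2019, §4 ("exchanging y with u and b with r")].

All `[folklore]` unless marked.
-/

noncomputable section

open MvPolynomial Finset

open scoped BigOperators

namespace Literature.Barriers.ResolutionOfSingularities

open Literature.AlgebraicGeometry.Resolution.Hauser2010

namespace HauserPerlega

section Orders

variable {σ : Type*} {K : Type*} [CommRing K]

/-- `ord F ≥ n` if all monomials of `F` have degree `≥ n` (support form of
`Literature.Barriers.ResolutionOfSingularities.le_ordZero_of_forall`, `KangarooShadeIncrease.lean`).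
[folklore] -/
theorem le_ordZero_of_forall_mem_support {F : MvPolynomial σ K} {n : ℕ}
    (h : ∀ e ∈ F.support, n ≤ e.degree) : (n : ℕ∞) ≤ ordZero F := by
  unfold ordZero
  apply MvPowerSeries.nat_le_order
  intro d hd
  rw [MvPolynomial.coeff_coe]
  by_contra hne
  exact absurd (h d (MvPolynomial.mem_support_iff.mpr hne)) (not_le.mpr hd)

/-- `ord F ≠ ⊤` for `F ≠ 0`. [folklore] -/
theorem ordZero_ne_top {F : MvPolynomial σ K} (hF : F ≠ 0) : ordZero F ≠ ⊤ := by
  unfold ordZero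
  rw [Ne, MvPowerSeries.order_eq_top_iff]
  exact fun h => hF (MvPolynomial.coe_eq_zero_iff.mp h)

/-- **Lower bound for the residual order, for every exceptional set.** If each `xᵢ` occurs with
exponent `≤ mᵢ` in some monomial of `F` and all monomials of `F` have degree `≥ N + Σᵢ mᵢ`, then
`residual.order_E F ≥ N` whatever `E = V(∏_{i∈Δ} xᵢ)` is (corollary of
`natCast_le_residualOrder_of_bounds`, whose hypotheses only involve `Δ`).
[cite: HauserPerlega2019, §2 (residual order)] -/
theorem le_residualOrder [Fintype σ] (Δ : Finset σ) {F : MvPolynomial σ K} (m : σ → ℕ) (N : ℕ)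
    (hm : ∀ i, ∃ e ∈ F.support, e i ≤ m i) (hN : ∀ e ∈ F.support, N + ∑ i, m i ≤ e.degree) :
    (N : ℕ∞) ≤ residualOrder Δ F := by
  classical
  refine natCast_le_residualOrder_of_bounds m N (fun i _ => ?_) (fun d hd => ?_)
  · obtain ⟨e, he, hei⟩ := hm i
    exact (ordAlong_le_apply_of_mem_support he i).trans (by exact_mod_cast hei)
  · exact le_trans (Nat.add_le_add_left (Finset.sum_le_univ_sum_of_nonneg fun _ => Nat.zero_le _) N)
      (hN d hd)

/-- The residual factor of `F ≠ 0` is non-zero. [folklore] -/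
theorem residualFactor_ne_zero (Δ : Finset σ) {F : MvPolynomial σ K} (hF : F ≠ 0) :
    residualFactor Δ F ≠ 0 := by
  classical
  obtain ⟨e, he⟩ := Finset.nonempty_of_ne_empty (mt MvPolynomial.support_eq_empty.mp hF)
  intro h0
  have hle : exceptionalExp Δ F ≤ e := exceptionalExp_le_exponent_of_mem_support Δ he
  have : coeff (e - exceptionalExp Δ F) (residualFactor Δ F) ≠ 0 := by
    rw [residualFactor, coeff_divMonomial, add_tsub_cancel_of_le hle]
    exact MvPolynomial.mem_support_iff.mp he
  exact this (by rw [h0, coeff_zero])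

/-- **The residual order of `F ≠ 0` is a natural number.** [folklore] -/
theorem exists_nat_eq_residualOrder (Δ : Finset σ) {F : MvPolynomial σ K} (hF : F ≠ 0) :
    ∃ d : ℕ, residualOrder Δ F = d :=
  ENat.ne_top_iff_exists.mp (ordZero_ne_top (residualFactor_ne_zero Δ hF)) |>.imp fun _ h => h.symm

/-- Cleaning a finite sum. [folklore] -/
theorem deletePthPowers_sum {ι : Type*} [DecidableEq σ] (q : ℕ) (s : Finset ι)
    (P : ι → MvPolynomial σ K) :
    deletePthPowers q (∑ i ∈ s, P i) = ∑ i ∈ s, deletePthPowers q (P i) := by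
  classical
  induction s using Finset.induction_on with
  | empty => simp [deletePthPowers_zero]
  | insert a s ha ih => rw [Finset.sum_insert ha, Finset.sum_insert ha, deletePthPowers_add, ih]

end Orders

section Seq

variable {σ : Type*} [DecidableEq σ] {K : Type*} [CommRing K]

/-- The sequence of cleaned `F`-parts generated from `F⁰` by the schedule `(j k, t k)` of point
blow-ups: `F^{k+1} = (x_{j_k}^{−q} π_k(F^k))_clean`. [cite: HauserPerlega2019, §2] -/
def seqF (q : ℕ) (j : ℕ → σ) (t : ℕ → σ → K) (F0 : MvPolynomial σ K) : ℕ → MvPolynomial σ K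
  | 0 => F0
  | k + 1 => blowupStep q (j k) (t k) (seqF q j t F0 k)

/-- The sequence of exceptional sets along the schedule: `Δ^{k+1} = {j_k} ∪ {i ∈ Δ^k : i ≠ j_k, tᵢ = 0}`.
[cite: HauserPerlega2019, §2 (the set B)] -/
def seqΔ (Δ0 : Finset σ) (j : ℕ → σ) (t : ℕ → σ → K) : ℕ → Finset σ
  | 0 => Δ0
  | k + 1 => newExceptional (seqΔ Δ0 j t k) (j k) (t k)

/-- `seqF` at `0`. [folklore] -/
@[simp] theorem seqF_zero (q : ℕ) (j : ℕ → σ) (t : ℕ → σ → K) (F0 : MvPolynomial σ K) :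
    seqF q j t F0 0 = F0 := rfl

/-- `seqF` at `k + 1`. [folklore] -/
theorem seqF_succ (q : ℕ) (j : ℕ → σ) (t : ℕ → σ → K) (F0 : MvPolynomial σ K) (k : ℕ) :
    seqF q j t F0 (k + 1) = blowupStep q (j k) (t k) (seqF q j t F0 k) := rfl

/-- **The generated sequence is a point blow-up sequence** as soon as `F⁰` is clean and the order of
`f = z^q + F^k` stays `q` (`ord F^k ≥ q`) for all `k`. [cite: HauserPerlega2019, §2] -/
theorem isPointBlowupSequence_seq {q : ℕ} {j : ℕ → σ} {t : ℕ → σ → K} {F0 : MvPolynomial σ K}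
    (Δ0 : Finset σ) (hclean : IsClean q F0) (hord : ∀ k, (q : ℕ∞) ≤ ordZero (seqF q j t F0 k)) :
    IsPointBlowupSequence q (seqF q j t F0) (seqΔ Δ0 j t) j t where
  clean k := by
    cases k with
    | zero => exact hclean
    | succ k => exact isClean_blowupStep q (j k) (t k) _
  ord_le := hord
  transform _ := rfl
  exceptional _ := rfl

end Seq

section Rename

variable {σ : Type*} {K : Type*} [CommRing K]

/-- Coefficients of a renamed polynomial (permutation of the variables). [folklore] -/
theorem coeff_rename_equiv (s : σ ≃ σ) (G : MvPolynomial σ K) (d : σ →₀ ℕ) :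
    coeff d (rename s G) = coeff (d.mapDomain s.symm) G := by
  have hd : d = (d.mapDomain s.symm).mapDomain s := by
    rw [← Finsupp.mapDomain_comp, Equiv.self_comp_symm, Finsupp.mapDomain_id]
  conv_lhs => rw [hd]
  exact coeff_rename_mapDomain s s.injective G _

/-- `q`-th power exponents are preserved by permutations. [folklore] -/
theorem isPthPowerExponent_mapDomain_equiv (q : ℕ) (s : σ ≃ σ) (d : σ →₀ ℕ) :
    IsPthPowerExponent q (d.mapDomain s) ↔ IsPthPowerExponent q d := by
  rw [isPthPowerExponent_iff, isPthPowerExponent_iff]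
  simp_rw [Finsupp.mapDomain_equiv_apply]
  exact ⟨fun h i => by simpa using h (s i), fun h i => h _⟩

/-- Renaming commutes with cleaning. [folklore] -/
theorem rename_deletePthPowers [DecidableEq σ] (s : σ ≃ σ) (q : ℕ) (G : MvPolynomial σ K) :
    rename s (deletePthPowers q G) = deletePthPowers q (rename s G) := by
  ext d
  rw [coeff_rename_equiv, coeff_deletePthPowers, coeff_deletePthPowers, coeff_rename_equiv]
  simp only [isPthPowerExponent_mapDomain_equiv]

/-- Renaming commutes with division by a monomial. [folklore] -/
theorem rename_divMonomial (s : σ ≃ σ) (G : MvPolynomial σ K) (m : σ →₀ ℕ) :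
    rename s (MvPolynomial.divMonomial G m) =
      MvPolynomial.divMonomial (rename s G) (m.mapDomain s) := by
  ext d
  rw [coeff_rename_equiv, coeff_divMonomial, coeff_divMonomial, coeff_rename_equiv,
    Finsupp.mapDomain_add, ← Finsupp.mapDomain_comp, Equiv.symm_comp_self, Finsupp.mapDomain_id]

/-- Renaming the variables in the point blow-up substitution. [folklore] -/
theorem rename_pointBlowupSubst [DecidableEq σ] (s : σ ≃ σ) (j : σ) (t : σ → K) (i : σ) :
    rename s (pointBlowupSubst j t i) = pointBlowupSubst (s j) (t ∘ s.symm) (s i) := by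
  unfold pointBlowupSubst
  by_cases hij : i = j
  · subst hij; simp [rename_X]
  · have : s i ≠ s j := fun h => hij (s.injective h)
    simp [hij, this, rename_X, map_mul, map_add]

/-- Renaming commutes with the total transform. [folklore] -/
theorem rename_totalTransform [DecidableEq σ] (s : σ ≃ σ) (j : σ) (t : σ → K)
    (F : MvPolynomial σ K) :
    rename s (totalTransform j t F) = totalTransform (s j) (t ∘ s.symm) (rename s F) := by
  unfold totalTransform
  rw [aeval_rename, ← AlgHom.comp_apply, comp_aeval]
  have : (fun i => rename s (pointBlowupSubst j t i)) = pointBlowupSubst (s j) (t ∘ s.symm) ∘ s :=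
    funext fun i => rename_pointBlowupSubst s j t i
  rw [this]

/-- Renaming commutes with `F ↦ x_j^{−q} π(F)`. [folklore] -/
theorem rename_transformResidual [DecidableEq σ] (s : σ ≃ σ) (q : ℕ) (j : σ) (t : σ → K) (F : MvPolynomial σ K) :
    rename s (transformResidual q j t F) = transformResidual q (s j) (t ∘ s.symm) (rename s F) := by
  unfold transformResidual
  rw [rename_divMonomial, rename_totalTransform, Finsupp.mapDomain_single]

/-- **Renaming commutes with the blow-up step.** [folklore] -/
theorem rename_blowupStep [DecidableEq σ] (s : σ ≃ σ) (q : ℕ) (j : σ) (t : σ → K) (F : MvPolynomial σ K) :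
    rename s (blowupStep q j t F) = blowupStep q (s j) (t ∘ s.symm) (rename s F) := by
  rw [blowupStep, rename_deletePthPowers, rename_transformResidual, blowupStep]

/-- Monomials of a renamed polynomial. [folklore] -/
theorem mem_support_rename_equiv (s : σ ≃ σ) (G : MvPolynomial σ K) (d : σ →₀ ℕ) :
    d ∈ (rename s G).support ↔ d.mapDomain s.symm ∈ G.support := by
  rw [MvPolynomial.mem_support_iff, MvPolynomial.mem_support_iff, coeff_rename_equiv]

/-- A degree bound on the monomials of `G` is a degree bound on those of `rename s G`. [folklore] -/
theorem degree_bound_rename (s : σ ≃ σ) (G : MvPolynomial σ K) (n : ℕ)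
    (h : ∀ e ∈ G.support, n ≤ e.degree) : ∀ e ∈ (rename s G).support, n ≤ e.degree := by
  intro e he
  rw [mem_support_rename_equiv] at he
  have := h _ he
  rwa [Finsupp.degree_mapDomain] at this

/-- The hypotheses of `le_residualOrder` transport along a renaming. [folklore] -/
theorem residualBound_rename [Fintype σ] (s : σ ≃ σ) {G : MvPolynomial σ K} {m : σ → ℕ} {N : ℕ}
    (hm : ∀ i, ∃ e ∈ G.support, e i ≤ m i) (hN : ∀ e ∈ G.support, N + ∑ i, m i ≤ e.degree) :
    (∀ i, ∃ e ∈ (rename s G).support, e i ≤ (m ∘ s.symm) i) ∧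
      ∀ e ∈ (rename s G).support, N + ∑ i, (m ∘ s.symm) i ≤ e.degree := by
  constructor
  · intro i
    obtain ⟨e, he, hei⟩ := hm (s.symm i)
    refine ⟨e.mapDomain s, ?_, ?_⟩
    · rw [mem_support_rename_equiv, ← Finsupp.mapDomain_comp, Equiv.symm_comp_self,
        Finsupp.mapDomain_id]
      exact he
    · rw [Finsupp.mapDomain_equiv_apply]
      exact hei
  · intro e he
    rw [mem_support_rename_equiv] at he
    have h1 := hN _ he
    rw [Finsupp.degree_mapDomain] at h1
    have : ∑ i, (m ∘ s.symm) i = ∑ i, m i := Equiv.sum_comp s.symm m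
    omega

end Rename

end HauserPerlega

end Literature.Barriers.ResolutionOfSingularities
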